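import Summits.NavierStokesRegularity.NavierStokesRegularity.Theorems.ExtremiserTransienceNearExtremalTransiencePerFlowOfFilamentSelectionAllTime
import Summits.NavierStokesRegularity.NavierStokesRegularity.Theorems.ExtremiserTransienceBackwardConePropagation
import HarnessLib

/-!
# LINE g10-β «tight-or-chain» — crux `NearExtremalTransiencePerFlow` (item stmt-NavierStokesRegularity-26567)

Route `ExtremiserTransience`; ideator seat ns-idea-5, generation g10, technique card «extremal-example mining».
No summit is proved by a line; the crux, the heart T♮ below and NS regularity remain OPEN.

## Thesis of the line.  The residual of record of this crux is `⟨26567⟩ ⇐ T1_zoom ∧ H′` (g9-β `Lines/filament_selection`): a COHERENT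
SELECTION theorem T1 whose limit is «an exactly extremal slice OR a TUBE SLICE», and the dynamic exclusion H′ of tube slices.  Mining the
extremal examples behind `IsTubeSlice` shows the disjunction is cut at the wrong place:

* OBSERVATION (gerrymandered exhaustions; planner-side reading, for the critic).  `IsTubeSlice w` asks for κ⋆-efficiency of the PLAIN
  RESTRICTED functionals along SOME exhaustion by bounded measurable sets `D k ⊇ B(0, ρ k)`.  The pointwise efficiency
  `e(x) = ⟨ω, Sω⟩ / (M‖ω‖‖∇ω‖)` is `+∞` at the centre of every strained vortex tube (there `∇ω = 0`, `ω ≠ 0`, `⟨ω̂,Sω̂⟩ > 0`), so a finite union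
  `U` of tiny balls around such points, chosen on one level set of `‖ω‖/‖∇ω‖` and with one sign of `⟨ω,Sω⟩`, has set-efficiency as large as we
  please, and `D k := B(0,ρ k) ∪ U_k` with `Z(U_k) ≫ Z(B(0,ρ k))`, `P(U_k) ≫ P(B(0,ρ k))` is `(κ⋆ - δ k)`-efficient.  Hence EVERY bounded smooth
  field with bounded gradient, infinite budget and strained cells recurring at infinity (efficient or not) is a tube slice: H′ / `NoTubeSlice`
  as typed are Liouville theorems for ALL recurrent slices, not statements about near-extremality.  (Nothing is refuted: H′ may still be
  true; it is just not the statement the residual meant.)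
* THE RE-CUT (this line).  Replace the tube alternative by an HONEST GEOMETRIC WITNESS that near-extremal families actually produce and that
  the g10-α ledger actually kills: LEVEL CHAINS OF EVERY LENGTH.  T♮ `TightOrChain`: a near-extremal height-1 family with eventual linear
  growth has centres, a subsequence and a pointwise limit `W₀` of translates which is EITHER an exactly extremal extended slice (the TIGHT
  branch of concentration-compactness: closed unconditionally by the landed `not_isExtremalSlice_of_typeIAncientMild`) OR has, for every `d`,
  a centre about which the level set `{‖W₀‖ ≥ η}` meets the `g`-neighbourhood of every sphere of radius `≤ d` (the NON-TIGHT branch).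
  T♮ is WEAKER than g10-α's C1 ∧ C2 (which force the second branch with one centre for all radii) and does NOT presuppose non-attainment of
  κ⋆ (α's cheapest falsifier, a `C_b^∞` attainer, does not touch T♮: an attainer just puts the family in the tight branch); and it is weaker
  than T1 in that it claims NO efficiency of the limit (efficiency is not upper-semicontinuous; chains are closed under pointwise limits).
* THE LEDGER, LOCALISED.  g10-α's packing lemma is re-proved here in CENTRED, FINITE-RADIUS form `LedgerCountLocal` (kernel-checked, no
  `sorry`): ubiquity about ANY centre up to an explicit radius `R₀(s,g,ρ,c,D,a,E)` already overdraws the dissipation budget.  With the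
  UNIFORM budget L1ᵘ (`E = E(K,A)`, which is what the local energy inequality gives anyway) and L2, plus the landed backward-cone propagation,
  this yields the kernel-checked `LocalChainLiouville`: for all `K, A, g, η > 0, s < 0` there is `d` such that NO slice `W s` of a Type-I
  ancient mild field with all-time linear growth `A` has a level-`η` chain of thickness `g` and length `d` about any centre.  So the
  non-tight branch dies by name, and the skeleton is `crux ⇐ T♮ ∧ L1ᵘ ∧ L2` (three registered stubs; heart T♮).

## Why this line and not the eleven on file.  It is the only line whose selection theorem (i) has an honest, limit-stable witness in the
non-compact branch, (ii) needs no H′/H/T3 (the infinite branch is closed in the kernel modulo two KNSS-class estimates), (iii) survives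
attainment of κ⋆.  Levers by name: concentration-compactness dichotomy for near-extremal families (new on this crux as the CUT of the
selection theorem) + the g10-α dissipation ledger (energy per unit length is non-renewable backward in time), localised.

## Registered stubs.  T♮ `stub_tightOrChain` (HEART, XL, static + elementary limit passage) · L1ᵘ `stub_uniformDissipationBudget` (L; local
energy inequality for the classical windows of a Type-I ancient mild field; constants uniform in `W`) · L2 `stub_violatorDissipation` (M;
verbatim the g10-α stub — one proof closes both).  Proved here: `ledgerCountLocal_holds`, `localChainLiouville_of`, the skeleton.

## Falsifiers / instrument.  Cheapest falsifier of T♮: a near-extremal sequence (deficit → 0, uniform `C^k` bounds, linear growth `A`) all of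
whose translates' limits are neither extremal nor long-chained — i.e. HIERARCHICALLY DILUTE near-extremisers (bounded clusters at every
linking scale whose mutual strain fully compensates the finite-size deficit).  Instrument row «DILUTE-GAP» (pre-registered on the g10-α card,
0 kit this generation): efficiency of `N ≤ 8` cells at spacing `d/λ ∈ {3,5,8,12}` vs the dense chain; T♮ predicts dilution LOWERS efficiency.
Disproof record: `Cruxes/NearExtremalTransiencePerFlow/` has NO `Disproof.lean` (nor has the parent crux); negatives index (5 NS entries):
none concerns ancient fields with linear growth, dissipation budgets, chains or selection dichotomies.
-/

noncomputable section

open scoped Topology InnerProductSpace RealInnerProductSpace ENNReal ContDiff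
open MeasureTheory Filter Set Metric Function
open Literature.Analysis Literature.Analysis.FluidPDE
open Summit.NavierStokesRegularity.NavierStokesRegularity.Theses.ExtremiserTransience
open Summit.NavierStokesRegularity.NavierStokesRegularity.Theorems
open Summit.NavierStokesRegularity.NavierStokesRegularity.Theorems.DepletionLadder.KStar.HalfSpace
open Summit.NavierStokesRegularity.NavierStokesRegularity.Theorems.NearExtremalTransiencePerFlow.ZoneTransversality
open Summit.NavierStokesRegularity.NavierStokesRegularity.Theorems.NearExtremalTransiencePerFlow.MemberSelection
open Summit.NavierStokesRegularity.NavierStokesRegularity.Theorems.NearExtremalTransiencePerFlow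

namespace Summit.NavierStokesRegularity.NavierStokesRegularity.Cruxes.NearExtremalTransiencePerFlow.TightOrChain

set_option linter.dupNamespace false

/-! ## §0 Vocabulary -/

/-- LINEAR LOCAL-ENERGY GROWTH AT EVERY TIME of an ancient field (unit viscosity): `∫_{B(x,R)}‖W τ‖² ≤ A·R` for all `τ < 0`, all centres,
all radii (delivered for zoom limits by the landed G′ `growthTransferFlow`). -/
def HasLinGrowthAllTime (A : ℝ) (W : ℝ → E3 → E3) : Prop :=
  ∀ τ : ℝ, τ < 0 → ∀ (x : E3) (R : ℝ), 0 < R → ∫ z in Metric.ball x R, ‖W τ z‖ ^ 2 ≤ A * R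

/-- A LEVEL CHAIN OF LENGTH `d` ABOUT `z₀` (thickness `g`, level `η`): the level set `{‖w‖ ≥ η}` meets the `g`-neighbourhood of every sphere
`{‖z - z₀‖ = r}`, `0 ≤ r ≤ d`.  A `g`-connected set of level points through `z₀` of diameter `≥ 2d` has it; it is stable under pointwise
limits of equi-Lipschitz fields (up to `g ↦ g+1`, `η ↦ η/2`), unlike any efficiency clause. -/
def ChainUpTo (g η : ℝ) (w : E3 → E3) (z₀ : E3) (d : ℝ) : Prop :=
  ∀ r : ℝ, 0 ≤ r → r ≤ d → ∃ z : E3, |‖z - z₀‖ - r| ≤ g ∧ η ≤ ‖w z‖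

/-- CHAINS OF EVERY LENGTH (centres may depend on the length): the honest geometric witness replacing `IsTubeSlice`. -/
def ChainsOfEveryLength (g η : ℝ) (w : E3 → E3) : Prop :=
  ∀ d : ℝ, ∃ z₀ : E3, ChainUpTo g η w z₀ d

/-- **Discrete intermediate-value lemma (how the chain branch is produced in practice).**  A `g`-WALK of level points — finitely many points
`p 0 = z₀, p 1, …, p N` with `η ≤ ‖w (p i)‖`, consecutive steps `‖p (i+1) - p i‖ ≤ g`, reaching `‖p N - z₀‖ ≥ d` — realises `ChainUpTo g η w z₀ d`:
for a radius `r ≤ d` take the FIRST index whose distance from `z₀` is `≥ r`; the previous one is `< r`, so that distance lies in `[r, r + g]`.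
In particular every `g`-connected cluster of the level set `{η ≤ ‖w‖}` of diameter `≥ 2d` carries a chain of length `d` about each of its points
realising the diameter, so T♮'s second branch follows from «the limit has `g`-connected level clusters of every diameter». -/
theorem chainUpTo_of_walk {g η d : ℝ} {w : E3 → E3} {z₀ : E3} {N : ℕ} (hg : 0 ≤ g) (p : ℕ → E3)
    (hp0 : p 0 = z₀) (hlev : ∀ i, i ≤ N → η ≤ ‖w (p i)‖) (hstep : ∀ i, i < N → ‖p (i + 1) - p i‖ ≤ g)
    (hfar : d ≤ ‖p N - z₀‖) : ChainUpTo g η w z₀ d := by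
  intro r hr hrd
  classical
  have hex : ∃ i, r ≤ ‖p i - z₀‖ := ⟨N, le_trans hrd hfar⟩
  have hi₀ : r ≤ ‖p (Nat.find hex) - z₀‖ := Nat.find_spec hex
  have hi₀N : Nat.find hex ≤ N := Nat.find_min' hex (le_trans hrd hfar)
  refine ⟨p (Nat.find hex), ?_, hlev _ hi₀N⟩
  rcases Nat.eq_zero_or_pos (Nat.find hex) with h0 | hpos
  · -- the walk starts at `z₀`, so `r = 0`
    rw [h0, hp0, sub_self, norm_zero] at hi₀
    rw [h0, hp0, sub_self, norm_zero]
    have hr0 : r = 0 := le_antisymm hi₀ hr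
    rw [hr0, sub_zero, abs_zero]; exact hg
  · obtain ⟨j, hj⟩ : ∃ j, Nat.find hex = j + 1 := ⟨Nat.find hex - 1, by omega⟩
    have hjlt : ¬ r ≤ ‖p j - z₀‖ := Nat.find_min hex (by rw [hj]; exact Nat.lt_succ_self j)
    have hjN : j < N := by omega
    have hst := hstep j hjN
    have htri : ‖p (j + 1) - z₀‖ ≤ ‖p (j + 1) - p j‖ + ‖p j - z₀‖ := norm_sub_le_norm_sub_add_norm_sub _ _ _
    rw [hj] at hi₀ ⊢
    rw [abs_le]; constructor <;> linarith [not_le.1 hjlt]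

/-- Corollary: walks of every extent give chains of every length. -/
theorem chainsOfEveryLength_of_walks {g η : ℝ} {w : E3 → E3} (hg : 0 ≤ g)
    (h : ∀ d : ℝ, ∃ (z₀ : E3) (N : ℕ) (p : ℕ → E3), p 0 = z₀ ∧ (∀ i, i ≤ N → η ≤ ‖w (p i)‖) ∧
      (∀ i, i < N → ‖p (i + 1) - p i‖ ≤ g) ∧ d ≤ ‖p N - z₀‖) : ChainsOfEveryLength g η w := by
  intro d
  obtain ⟨z₀, N, p, hp0, hlev, hstep, hfar⟩ := h d
  exact ⟨z₀, chainUpTo_of_walk hg p hp0 hlev hstep hfar⟩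

/-- The SPACE-TIME DISSIPATION MEASURE of `W : ℝ → ℝ³ → ℝ³`: Lebesgue measure on `ℝ × ℝ³` with density `‖∇W(τ)(x)‖²`. -/
def dissMeasure (W : ℝ → E3 → E3) : Measure (ℝ × E3) :=
  (volume : Measure (ℝ × E3)).withDensity fun p => ‖fderiv ℝ (W p.1) p.2‖ₑ ^ 2

/-! ## §1 The statements of the line (L3ˡᵒᶜ and the local Liouville theorem are PROVED in §2; T♮, L1ᵘ, L2 are the registered stubs of §3) -/

/-- (L1ᵘ — provable, L) UNIFORM DISSIPATION BUDGET: for all `K, A` there is `E = E(K,A)` such that every Type-I ancient mild field (constant `K`)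
with all-time linear growth `A` dissipates at most `E·R` in every parabolic cylinder `[τ₁,τ₂] × B(x,R)` with `-τ₁ ≤ R²` (`τ₁ < τ₂ < 0`).  Local
energy inequality on the classical windows (`IsTypeIAncientMild.exists_isClassicalNSSolutionOn_Ioo`) with a cut-off adapted to `B(x,2R)`:
initial energy `≤ 2AR`; `|W|²Δφ`-term `≤ 2AR`; cubic flux `≤ 4AKR`; pressure = Riesz pressure mod constants
(`pressure_eq_pressurePotentialMod_add_const`), near part like the cubic term, far part `∇p_far = O(KA/(R²√(-τ)))`; every constant depends on
`K, A` only.  Why it might fail: it does not (KNSS-class local energy theory); size is the only risk.  It implies g10-α's `DissipationBudget`. -/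
def UniformDissipationBudget : Prop :=
  ∀ (K A : ℝ), ∃ E : ℝ, ∀ (W : ℝ → E3 → E3), IsTypeIAncientMild K W → HasLinGrowthAllTime A W →
    ∀ (x : E3) (R τ₁ τ₂ : ℝ), 0 < R → τ₁ < τ₂ → τ₂ < 0 → -τ₁ ≤ R ^ 2 →
      dissMeasure W (Set.Icc τ₁ τ₂ ×ˢ Metric.ball x R) ≤ ENNReal.ofReal (E * R)

/-- (L2 — provable, M; verbatim the g10-α stub) A LEVEL POINT SPENDS DISSIPATION: for `K, A, ε > 0` there are `c, D > 0` and `0 < a < 1` such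
that for every Type-I ancient mild field `W` (constant `K`) with all-time linear growth `A`, every level point `√(-τ)‖W τ x‖ > ε` forces
`∬_{[(1+a)τ, τ] × B(x, D√(-τ))} ‖∇W‖² ≥ c√(-τ)` (derivative bounds keep the level on a parabolic box; linear growth makes the spherical mean
small at radius `D√(-τ)`; the radial drop costs Dirichlet energy by Cauchy–Schwarz).  Why it might fail: it does not; the constants are explicit. -/
def ViolatorDissipation : Prop :=
  ∀ (K A ε : ℝ), 0 < ε → ∃ (c D a : ℝ), 0 < c ∧ 0 < D ∧ 0 < a ∧ a < 1 ∧
    ∀ (W : ℝ → E3 → E3), IsTypeIAncientMild K W → HasLinGrowthAllTime A W →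
      ∀ (τ : ℝ) (x : E3), τ < 0 → ε < Real.sqrt (-τ) * ‖W τ x‖ →
        ENNReal.ofReal (c * Real.sqrt (-τ)) ≤
          dissMeasure W (Set.Icc ((1 + a) * τ) τ ×ˢ Metric.ball x (D * Real.sqrt (-τ)))

/-- (L3ˡᵒᶜ — PROVED below, `ledgerCountLocal_holds`) THE LOCAL LEDGER COUNT: for the constants `s < 0`, `g ≥ 0`, `ρ, c, D > 0`, `0 < a < 1`, `E`
there is an explicit radius `R₀ > 0` such that for every measure `μ` on `ℝ × ℝ³`, predicate `P` and centre `x₀`: (U) `P`-points at time `s`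
within `g` of every sphere about `x₀` of radius `≤ R₀`, (Per) one-step backward propagation with drift `ρ√(-τ)`, (Spend) `c√(-τ)` per
`P`-point on its box, (Budget) `μ([τ₁,τ₂] × B(x₀,R)) ≤ E·R` when `-τ₁ ≤ R²` — are contradictory.  (g10-α's `LedgerCount` is the case
`x₀ = 0` with (U) for all radii; the proof is the same packing, with `R₀` chosen before `μ, P, x₀`.) -/
def LedgerCountLocal : Prop :=
  ∀ (s g ρ c D a E : ℝ), s < 0 → 0 ≤ g → 0 < ρ → 0 < c → 0 < D → 0 < a → a < 1 →
    ∃ R₀ : ℝ, 0 < R₀ ∧ ∀ (μ : Measure (ℝ × E3)) (P : ℝ → E3 → Prop) (x₀ : E3),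
      (∀ r : ℝ, 0 ≤ r → r ≤ R₀ → ∃ z : E3, |‖z - x₀‖ - r| ≤ g ∧ P s z) →
      (∀ (τ : ℝ) (x : E3), τ < 0 → P τ x → ∃ x' : E3, ‖x' - x‖ ≤ ρ * Real.sqrt (-τ) ∧ P (36 * τ) x') →
      (∀ (τ : ℝ) (x : E3), τ < 0 → P τ x →
        ENNReal.ofReal (c * Real.sqrt (-τ)) ≤ μ (Set.Icc ((1 + a) * τ) τ ×ˢ Metric.ball x (D * Real.sqrt (-τ)))) →
      (∀ (R τ₁ τ₂ : ℝ), 0 < R → τ₁ < τ₂ → τ₂ < 0 → -τ₁ ≤ R ^ 2 →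
        μ (Set.Icc τ₁ τ₂ ×ˢ Metric.ball x₀ R) ≤ ENNReal.ofReal (E * R)) →
      False

/-- (THE LOCAL LIOUVILLE THEOREM — kernel-checked below from L1ᵘ, L2, L3ˡᵒᶜ and the landed backward-cone propagation) LOCAL CHAIN LIOUVILLE:
for all `K, A, g`, `η > 0`, `s < 0` there is a length `d > 0` such that no slice `W s` of a Type-I ancient mild field (constant `K`) with
all-time linear growth `A` carries a level-`η` chain of thickness `g` and length `d` about any centre.  It implies g10-α's
`UbiquitousSliceLiouville` and kills, by name, every limit in the non-tight branch of T♮ (and every necklace whose cluster length is unbounded,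
dilute or not). -/
def LocalChainLiouville : Prop :=
  ∀ (K A g η s : ℝ), s < 0 → 0 < η → ∃ d : ℝ, 0 < d ∧ ∀ (W : ℝ → E3 → E3) (z₀ : E3),
    IsTypeIAncientMild K W → HasLinGrowthAllTime A W → ¬ ChainUpTo g η (W s) z₀ d

/-- (T♮ — THE HEART, XL) TIGHT-OR-CHAIN: a near-extremal height-`1` family (`NearExtremalFamily v Λ Θ ε`: smooth, divergence-free, `‖v n‖ ≤ 1`,
`‖D^k v n‖ ≤ Λ k`, finite budgets, deficit `ε n → 0` at height `1`, Taylor bound `Z ≤ Θ P`) whose members eventually have linear growth `A`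
admits centres `y`, a subsequence `φ` and a pointwise limit `W₀` of the translates `v (φ n) (y (φ n) + ·)` such that EITHER `W₀` is an exactly
extremal extended slice (`IsExtremalSlice`; the tight branch) OR `W₀` has level-`η` chains of thickness `g` of every length (`η > 0`; the
non-tight branch).  Mechanism: concentration-compactness for the maximising structure at fixed height — if some centring makes the enstrophy
/ palinstrophy profiles tight, uniform `C^k` bounds give `C^∞_loc` convergence, lower semicontinuity of the deficit-free inequality
(`extendedSharp`) and Fatou give an exactly extremal limit; if no centring is tight, the CS-weight `√(Z_i P_i)` of the family delocalises over
unboundedly many cells of Taylor scale `≍ 1` (share bound `share_le_of_taylor`), linear growth confines them to a `g`-neighbourhood of a curve,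
and vanishing deficit forbids gaps that do not close (a gap's strain gain is `O(g⁻⁴)`, a finite cluster's deficit is not) — so the longest
cluster length diverges and centring on it gives the chains in the limit.  Why it might fail: hierarchically dilute near-extremisers
(bounded clusters at every linking scale, mutual strain compensating the finite-size deficit) are excluded by no theorem; instrument row
«DILUTE-GAP» would measure it.  Sources: Lions' concentration-compactness I/II (1984) for the dichotomy; this seat's records j320466/j321232;
`Lines/filament_selection.lean` (T1, of which T♮ is the honest re-cut); `Lines/dissipation_ledger.lean` (C1 ∧ C2 ⇒ T♮). -/
def TightOrChain : Prop :=
  ∀ (v : ℕ → E3 → E3) (Λ : ℕ → ℝ) (Θ : ℝ) (ε : ℕ → ℝ) (A : ℝ),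
    NearExtremalFamily v Λ Θ ε →
    (∀ᶠ n in atTop, ∀ (x : E3) (R : ℝ), 0 < R → ∫ z in Metric.ball x R, ‖v n z‖ ^ 2 ≤ A * R) →
    ∃ (y : ℕ → E3) (φ : ℕ → ℕ) (W₀ : E3 → E3), StrictMono φ ∧
      (∀ z : E3, Tendsto (fun n => v (φ n) (y (φ n) + z)) atTop (𝓝 (W₀ z))) ∧
      (IsExtremalSlice W₀ ∨ ∃ g η : ℝ, 0 < η ∧ ChainsOfEveryLength g η W₀)

/-! ## §1b T♮ at member level and the kernel-checked limit passage `tightOrChain_of_members : TightOrChainMembers → TightOrChain` -/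

/-- Equi-Lipschitz from the first-derivative bound. -/
theorem lipschitz_of_iteratedFDeriv_one {f : E3 → E3} {Λ₁ : ℝ} (hf : ContDiff ℝ (⊤ : ℕ∞) f)
    (hΛ : ∀ x, ‖iteratedFDeriv ℝ 1 f x‖ ≤ Λ₁) (a b : E3) : ‖f a - f b‖ ≤ Λ₁ * ‖a - b‖ := by
  have hdiff : ∀ x ∈ (Set.univ : Set E3), DifferentiableAt ℝ f x := fun x _ =>
    (hf.differentiable (by simp)).differentiableAt
  have hbound : ∀ x ∈ (Set.univ : Set E3), ‖fderiv ℝ f x‖ ≤ Λ₁ := by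
    intro x _
    have h : ‖fderiv ℝ f x‖ = ‖iteratedFDeriv ℝ 1 f x‖ := by
      rw [← norm_iteratedFDeriv_fderiv, norm_iteratedFDeriv_zero]
    rw [h]; exact hΛ x
  exact convex_univ.norm_image_sub_le_of_norm_fderiv_le hdiff hbound (Set.mem_univ b) (Set.mem_univ a)

theorem shell_points_of_limit (v : ℕ → E3 → E3) (Λ₁ g η : ℝ) (y : ℕ → E3) (d : ℕ → ℝ) (w : E3 → E3)
    (hcd : ∀ n, ContDiff ℝ (⊤ : ℕ∞) (v n)) (hΛ : ∀ n (x : E3), ‖iteratedFDeriv ℝ 1 (v n) x‖ ≤ Λ₁)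
    (hd : Tendsto d atTop atTop)
    (hub : ∀ n, ∀ r : ℝ, 0 ≤ r → r ≤ d n → ∃ z : E3, |‖z - y n‖ - r| ≤ g ∧ η ≤ ‖v n z‖)
    (hconv : ∀ z : E3, Tendsto (fun n => v n (y n + z)) atTop (𝓝 (w z))) :
    ∀ r : ℝ, 0 ≤ r → ∃ z : E3, |‖z‖ - r| ≤ g + 1 ∧ η / 2 ≤ ‖w z‖ := by
  intro r hr
  -- eventually the member is ubiquitous up to radius `r`
  have hev : ∀ᶠ n in atTop, ∃ z : E3, |‖z - y n‖ - r| ≤ g ∧ η ≤ ‖v n z‖ := by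
    filter_upwards [hd.eventually_ge_atTop r] with n hn
    exact hub n r hr hn
  obtain ⟨φ₀, hφ₀, hP⟩ := extraction_of_eventually_atTop hev
  choose z hz using hP
  -- the relative positions live in a compact ball
  set ζ : ℕ → E3 := fun n => z n - y (φ₀ n) with hζdef
  have hζmem : ∀ n, ζ n ∈ Metric.closedBall (0 : E3) (r + g) := by
    intro n
    rw [Metric.mem_closedBall, dist_zero_right]
    have h := (abs_le.1 (hz n).1).2
    show ‖z n - y (φ₀ n)‖ ≤ r + g
    linarith
  obtain ⟨ζs, -, ψ, hψ, hζs⟩ := (isCompact_closedBall (0 : E3) (r + g)).tendsto_subseq hζmem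
  -- the limit position is within `g` of the sphere of radius `r`
  have hshell : |‖ζs‖ - r| ≤ g := by
    have h1 : Tendsto (fun n => |‖ζ (ψ n)‖ - r|) atTop (𝓝 |‖ζs‖ - r|) :=
      ((continuous_abs.tendsto _).comp ((continuous_norm.tendsto _).comp hζs |>.sub_const r))
    exact le_of_tendsto' h1 fun n => (hz (ψ n)).1
  -- the value of the limit field there
  have hconv' : Tendsto (fun n => ‖v (φ₀ (ψ n)) (y (φ₀ (ψ n)) + ζs)‖) atTop (𝓝 ‖w ζs‖) :=
    ((hconv ζs).comp ((hφ₀.comp hψ).tendsto_atTop)).norm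
  have hlow : Tendsto (fun n => η - Λ₁ * ‖ζs - ζ (ψ n)‖) atTop (𝓝 η) := by
    have h1 : Tendsto (fun n => ζs - ζ (ψ n)) atTop (𝓝 (ζs - ζs)) := tendsto_const_nhds.sub hζs
    rw [sub_self] at h1
    have h2 : Tendsto (fun n => ‖ζs - ζ (ψ n)‖) atTop (𝓝 0) := by
      simpa using h1.norm
    have h3 : Tendsto (fun n => η - Λ₁ * ‖ζs - ζ (ψ n)‖) atTop (𝓝 (η - Λ₁ * 0)) :=
      tendsto_const_nhds.sub (tendsto_const_nhds.mul h2)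
    simpa using h3
  have hle : ∀ n, η - Λ₁ * ‖ζs - ζ (ψ n)‖ ≤ ‖v (φ₀ (ψ n)) (y (φ₀ (ψ n)) + ζs)‖ := by
    intro n
    have hlip := lipschitz_of_iteratedFDeriv_one (hcd (φ₀ (ψ n))) (hΛ (φ₀ (ψ n)))
      (y (φ₀ (ψ n)) + ζs) (y (φ₀ (ψ n)) + ζ (ψ n))
    have hzeq : y (φ₀ (ψ n)) + ζ (ψ n) = z (ψ n) := by
      show y (φ₀ (ψ n)) + (z (ψ n) - y (φ₀ (ψ n))) = z (ψ n)
      abel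
    rw [hzeq, show y (φ₀ (ψ n)) + ζs - z (ψ n) = ζs - ζ (ψ n) by
      show y (φ₀ (ψ n)) + ζs - z (ψ n) = ζs - (z (ψ n) - y (φ₀ (ψ n))); abel] at hlip
    have hη := (hz (ψ n)).2
    have htri : ‖v (φ₀ (ψ n)) (z (ψ n))‖ - ‖v (φ₀ (ψ n)) (y (φ₀ (ψ n)) + ζs) - v (φ₀ (ψ n)) (z (ψ n))‖ ≤
        ‖v (φ₀ (ψ n)) (y (φ₀ (ψ n)) + ζs)‖ := by
      have := norm_sub_norm_le (v (φ₀ (ψ n)) (z (ψ n))) (v (φ₀ (ψ n)) (y (φ₀ (ψ n)) + ζs))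
      rw [norm_sub_rev] at this
      linarith
    linarith
  have hwη : η ≤ ‖w ζs‖ := le_of_tendsto_of_tendsto' hlow hconv' hle
  refine ⟨ζs, ?_, ?_⟩
  · linarith [hshell, abs_nonneg (‖ζs‖ - r)]
  · rcases le_or_gt 0 η with h | h
    · linarith
    · linarith [norm_nonneg (w ζs)]


/-- **T♮ at MEMBER level** (what a prover actually establishes): the same dichotomy, with the chain branch stated on the MEMBERS about the
chosen centres — chains of thickness `g`, level `η`, up to lengths `d n → ∞` — instead of on the limit. -/
def TightOrChainMembers : Prop :=
  ∀ (v : ℕ → E3 → E3) (Λ : ℕ → ℝ) (Θ : ℝ) (ε : ℕ → ℝ) (A : ℝ),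
    NearExtremalFamily v Λ Θ ε →
    (∀ᶠ n in atTop, ∀ (x : E3) (R : ℝ), 0 < R → ∫ z in Metric.ball x R, ‖v n z‖ ^ 2 ≤ A * R) →
    ∃ (y : ℕ → E3) (φ : ℕ → ℕ) (W₀ : E3 → E3), StrictMono φ ∧
      (∀ z : E3, Tendsto (fun n => v (φ n) (y (φ n) + z)) atTop (𝓝 (W₀ z))) ∧
      (IsExtremalSlice W₀ ∨
        ∃ g η : ℝ, 0 < η ∧ ∃ d : ℕ → ℝ, Tendsto d atTop atTop ∧ ∀ n, ChainUpTo g η (v (φ n)) (y (φ n)) (d n))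

/-- **Kernel-checked reduction T♮ ⇐ T♮ₘₑₘ** (the limit passage of the chain branch is done here once and for all, by `shell_points_of_limit`
with the family's uniform gradient bound `Λ 1`): member chains about the centres become `ChainsOfEveryLength (g+1) (η/2)` of the limit, all about
the origin of the moving frame. -/
theorem tightOrChain_of_members (h : TightOrChainMembers) : TightOrChain := by
  intro v Λ Θ ε A hfam hgr
  obtain ⟨y, φ, W₀, hφ, hconv, hdich⟩ := h v Λ Θ ε A hfam hgr
  refine ⟨y, φ, W₀, hφ, hconv, ?_⟩
  rcases hdich with hext | ⟨g, η, hη, d, hd, hchain⟩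
  · exact Or.inl hext
  · right
    refine ⟨g + 1, η / 2, by linarith, ?_⟩
    have hcd : ∀ n, ContDiff ℝ (⊤ : ℕ∞) (v (φ n)) := fun n => hfam.1 (φ n)
    have hΛ : ∀ n (x : E3), ‖iteratedFDeriv ℝ 1 (v (φ n)) x‖ ≤ Λ 1 := fun n x => hfam.2.2.2.1 1 (φ n) x
    have hshell := shell_points_of_limit (fun n => v (φ n)) (Λ 1) g η (fun n => y (φ n)) d W₀ hcd hΛ hd
      (fun n r hr hrd => hchain n r hr hrd) hconv
    intro D
    refine ⟨0, fun r hr _ => ?_⟩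
    obtain ⟨z, hz, hzη⟩ := hshell r hr
    exact ⟨z, by simpa using hz, hzη⟩

/-- **T♮ via CLUSTER GROWTH** (the natural prover target, member level): tight, OR for some thickness `g ≥ 0` and level `η > 0` the members
carry `g`-WALKS of level points from the centres reaching distances `d n → ∞` (e.g. inside `g`-connected `η`-level clusters of diameter `→ ∞`
containing the centres). -/
def TightOrClusterGrowth : Prop :=
  ∀ (v : ℕ → E3 → E3) (Λ : ℕ → ℝ) (Θ : ℝ) (ε : ℕ → ℝ) (A : ℝ),
    NearExtremalFamily v Λ Θ ε →
    (∀ᶠ n in atTop, ∀ (x : E3) (R : ℝ), 0 < R → ∫ z in Metric.ball x R, ‖v n z‖ ^ 2 ≤ A * R) →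
    ∃ (y : ℕ → E3) (φ : ℕ → ℕ) (W₀ : E3 → E3), StrictMono φ ∧
      (∀ z : E3, Tendsto (fun n => v (φ n) (y (φ n) + z)) atTop (𝓝 (W₀ z))) ∧
      (IsExtremalSlice W₀ ∨
        ∃ g η : ℝ, 0 ≤ g ∧ 0 < η ∧ ∃ d : ℕ → ℝ, Tendsto d atTop atTop ∧
          ∀ n, ∃ (N : ℕ) (p : ℕ → E3), p 0 = y (φ n) ∧ (∀ i, i ≤ N → η ≤ ‖v (φ n) (p i)‖) ∧
            (∀ i, i < N → ‖p (i + 1) - p i‖ ≤ g) ∧ d n ≤ ‖p N - y (φ n)‖)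

/-- Cluster growth ⇒ member chains (by the walk lemma). -/
theorem tightOrChainMembers_of_clusterGrowth (h : TightOrClusterGrowth) : TightOrChainMembers := by
  intro v Λ Θ ε A hfam hgr
  obtain ⟨y, φ, W₀, hφ, hconv, hdich⟩ := h v Λ Θ ε A hfam hgr
  refine ⟨y, φ, W₀, hφ, hconv, ?_⟩
  rcases hdich with hext | ⟨g, η, hg, hη, d, hd, hwalk⟩
  · exact Or.inl hext
  · refine Or.inr ⟨g, η, hη, d, hd, fun n => ?_⟩
    obtain ⟨N, p, hp0, hlev, hstep, hfar⟩ := hwalk n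
    exact chainUpTo_of_walk hg p hp0 hlev hstep hfar

/-- Cluster growth ⇒ T♮ (kernel-checked chain: walk lemma + limit passage). -/
theorem tightOrChain_of_clusterGrowth (h : TightOrClusterGrowth) : TightOrChain :=
  tightOrChain_of_members (tightOrChainMembers_of_clusterGrowth h)

/-! ## §2 The local ledger: L1ᵘ + L2 + L3ˡᵒᶜ + backward-cone propagation ⇒ `LocalChainLiouville` (kernel-checked, no `sorry`) -/

/-- **Local chain Liouville from the local ledger.**  Level `ε = min(ε₁, η√(-s)/2)`; radius `d = R₀` of L3ˡᵒᶜ; a negative thickness is vacuous. -/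
theorem localChainLiouville_of_ledger (h3 : LedgerCountLocal) (h1 : UniformDissipationBudget) (h2 : ViolatorDissipation) :
    LocalChainLiouville := by
  intro K A g η s hs hη
  by_cases hg : 0 ≤ g
  swap
  · refine ⟨1, one_pos, fun W z₀ _ _ hch => ?_⟩
    obtain ⟨z, hz, -⟩ := hch 0 le_rfl zero_le_one
    exact hg ((abs_nonneg _).trans hz)
  obtain ⟨ε₁, hε₁, hper⟩ := ScrewSymmetricLiouville.exists_backwardCone_violator
  have hsq : 0 < Real.sqrt (-s) := Real.sqrt_pos.2 (neg_pos.2 hs)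
  obtain ⟨ε, hε, hεε₁, hεη⟩ : ∃ ε : ℝ, 0 < ε ∧ ε ≤ ε₁ ∧ ε < η * Real.sqrt (-s) := by
    refine ⟨min ε₁ (η * Real.sqrt (-s) / 2), lt_min hε₁ (by positivity), min_le_left _ _, ?_⟩
    have h1 : η * Real.sqrt (-s) / 2 < η * Real.sqrt (-s) := half_lt_self (by positivity)
    exact lt_of_le_of_lt (min_le_right _ _) h1
  obtain ⟨ρ, hρ, hρW⟩ := hper ε hε hεε₁ K
  obtain ⟨c, D, a, hc, hD, ha, ha1, hsp⟩ := h2 K A ε hε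
  obtain ⟨E, hE⟩ := h1 K A
  obtain ⟨R₀, hR₀, hcount⟩ := h3 s g ρ c D a E hs hg hρ hc hD ha ha1
  refine ⟨R₀, hR₀, fun W z₀ hW hgr hch => ?_⟩
  refine hcount (dissMeasure W) (fun τ x => ε < Real.sqrt (-τ) * ‖W τ x‖) z₀ ?_ ?_ ?_ ?_
  · intro r hr hrR
    obtain ⟨z, hz, hzη⟩ := hch r hr hrR
    refine ⟨z, hz, ?_⟩
    show ε < Real.sqrt (-s) * ‖W s z‖
    calc ε < η * Real.sqrt (-s) := hεη
      _ = Real.sqrt (-s) * η := mul_comm _ _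
      _ ≤ Real.sqrt (-s) * ‖W s z‖ := by gcongr
  · intro τ x hτ hP
    exact hρW W hW τ hτ x hP
  · intro τ x hτ hP
    exact hsp W hW hgr τ x hτ hP
  · intro R τ₁ τ₂ hR h12 h2' hτR
    exact hE W hW hgr z₀ R τ₁ τ₂ hR h12 h2' hτR

set_option maxHeartbeats 1600000 in
/-- **L3ˡᵒᶜ is a THEOREM** (elementary packing, kernel-checked; no `sorry`): the CENTRED, FINITE-RADIUS ledger arithmetic. -/
theorem ledgerCountLocal_holds : LedgerCountLocal := by
  intro s g ρ c D a E hs hg hρ hc hD ha ha1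
  -- ### scales: `L0 = √(-s)`, epoch lengths `L k = 6^k L0`, epoch times `τ k = 36^k s`
  obtain ⟨L0, hL0⟩ : ∃ L0 : ℝ, L0 = Real.sqrt (-s) := ⟨_, rfl⟩
  have hL0pos : 0 < L0 := by rw [hL0]; exact Real.sqrt_pos.2 (neg_pos.2 hs)
  have hL0sq : L0 ^ 2 = -s := by rw [hL0]; exact Real.sq_sqrt (neg_pos.2 hs).le
  obtain ⟨L, hL⟩ : ∃ L : ℕ → ℝ, ∀ k, L k = 6 ^ k * L0 := ⟨_, fun _ => rfl⟩
  obtain ⟨τ, hτ⟩ : ∃ τ : ℕ → ℝ, ∀ k, τ k = 36 ^ k * s := ⟨_, fun _ => rfl⟩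
  have hLpos : ∀ k, 0 < L k := fun k => by rw [hL]; positivity
  have hτneg : ∀ k, τ k < 0 := fun k => by rw [hτ]; exact mul_neg_of_pos_of_neg (by positivity) hs
  have h36 : ∀ k : ℕ, (36 : ℝ) ^ k = (6 ^ k) ^ 2 := fun k => by
    rw [← pow_mul, mul_comm, pow_mul]; norm_num
  have hsqrtτ : ∀ k, Real.sqrt (-(τ k)) = L k := by
    intro k
    rw [hτ, hL, hL0, show -(36 ^ k * s) = ((6 : ℝ) ^ k) ^ 2 * (-s) by rw [h36]; ring,
      Real.sqrt_mul (sq_nonneg _), Real.sqrt_sq (by positivity)]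
  have hLsq : ∀ k, L k ^ 2 = -(τ k) := fun k => by
    rw [hL, hτ, mul_pow, ← h36, hL0sq]; ring
  have hLmono : ∀ {k k' : ℕ}, k ≤ k' → L k ≤ L k' := by
    intro k k' hkk'
    rw [hL, hL]
    exact mul_le_mul_of_nonneg_right (pow_le_pow_right₀ (by norm_num) hkk') hL0pos.le
  have hL0le : ∀ k, L0 ≤ L k := fun k => by
    have h0 : L 0 = L0 := by rw [hL]; simp
    rw [← h0]; exact hLmono (Nat.zero_le k)
  have hτmono : ∀ {k k' : ℕ}, k ≤ k' → τ k' ≤ τ k := by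
    intro k k' hkk'
    rw [hτ, hτ]
    exact mul_le_mul_of_nonpos_right (pow_le_pow_right₀ (by norm_num) hkk') hs.le
  have hτles : ∀ k, τ k ≤ s := fun k => by
    rw [hτ]; exact mul_le_of_one_le_left hs.le (one_le_pow₀ (by norm_num))
  -- ### spacings `σ k`, the comparison constant `Γ`, the number of epochs `k₁`, the radius `R₀` — all BEFORE `μ, P, x₀`
  obtain ⟨σ, hσ⟩ : ∃ σ : ℕ → ℝ, ∀ k, σ k = 2 * g + 2 * ρ * L k + 2 * D * L k := ⟨_, fun _ => rfl⟩
  have hσpos : ∀ k, 0 < σ k := fun k => by rw [hσ]; nlinarith [hLpos k, hρ, hD]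
  obtain ⟨E', hE'0, hEE'⟩ : ∃ E' : ℝ, 0 ≤ E' ∧ E ≤ E' := ⟨max E 0, le_max_right _ _, le_max_left _ _⟩
  obtain ⟨Γ, hΓ⟩ : ∃ Γ : ℝ, Γ = 2 * g / L0 + 2 * ρ + 2 * D := ⟨_, rfl⟩
  have hΓpos : 0 < Γ := by rw [hΓ]; positivity
  have hσΓ : ∀ k, σ k ≤ Γ * L k := by
    intro k
    have h1 : 2 * g ≤ 2 * g / L0 * L k := by
      rw [div_mul_eq_mul_div, le_div_iff₀ hL0pos]
      exact mul_le_mul_of_nonneg_left (hL0le k) (by positivity)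
    rw [hσ, hΓ]; nlinarith [h1, hLpos k]
  obtain ⟨k₁, hk₁⟩ : ∃ k₁ : ℕ, Γ * (E' + 1) / c ≤ (k₁ : ℝ) := ⟨_, Nat.le_ceil _⟩
  have hcoef : (E' + 1) * Γ ≤ ((k₁ : ℝ) + 1) * c := by
    have h1 := (div_le_iff₀ hc).1 hk₁
    nlinarith [hc, hΓpos, hE'0]
  obtain ⟨R₀, hR₀⟩ : ∃ R₀ : ℝ, R₀ = σ 0 + E' * g + (E' * (ρ + D + 2) + ((k₁ : ℝ) + 1) * c) * L k₁ + 1 :=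
    ⟨_, rfl⟩
  have hR₀A : 0 ≤ (E' * (ρ + D + 2) + ((k₁ : ℝ) + 1) * c) * L k₁ :=
    mul_nonneg (by positivity) (hLpos k₁).le
  have hR₀B : 0 ≤ E' * g := mul_nonneg hE'0 hg
  have hR₀pos : 0 < R₀ := by
    rw [hR₀]; linarith [hσpos 0, hR₀A, hR₀B]
  obtain ⟨m, hm⟩ : ∃ m : ℕ → ℕ, ∀ k, m k = ⌊R₀ / σ k⌋₊ := ⟨_, fun _ => rfl⟩
  have hmle : ∀ k, (m k : ℝ) ≤ R₀ / σ k := fun k => by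
    rw [hm]; exact Nat.floor_le (div_nonneg hR₀pos.le (hσpos k).le)
  have hmge : ∀ k, R₀ / σ k - 1 ≤ (m k : ℝ) := fun k => by
    rw [hm]; exact (Nat.sub_one_lt_floor _).le
  have hiσ : ∀ k i, i < m k → (i : ℝ) * σ k ≤ R₀ := by
    intro k i hi
    have h2 : (i : ℝ) ≤ m k := by exact_mod_cast hi.le
    have h3 := hmle k
    rw [le_div_iff₀ (hσpos _)] at h3
    calc (i : ℝ) * σ k ≤ (m k : ℝ) * σ k := mul_le_mul_of_nonneg_right h2 (hσpos k).le
      _ ≤ R₀ := h3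
  obtain ⟨R, hR⟩ : ∃ R : ℝ, R = R₀ + g + (ρ + D + 2) * L k₁ := ⟨_, rfl⟩
  have hRpos : 0 < R := by rw [hR]; nlinarith [hLpos k₁, hρ, hD]
  refine ⟨R₀, hR₀pos, ?_⟩
  intro μ P x₀ hU hPer hSp hBud
  -- ### iterated backward propagation with parabolic drift `≤ ρ L k`
  have hiter : ∀ (k : ℕ) (z : E3), P s z → ∃ x : E3, ‖x - z‖ ≤ ρ * L k ∧ P (τ k) x := by
    intro k
    induction k with
    | zero =>
      intro z hz
      refine ⟨z, ?_, ?_⟩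
      · rw [sub_self, norm_zero]; exact (mul_pos hρ (hLpos 0)).le
      · rw [hτ]; simpa using hz
    | succ k ih =>
      intro z hz
      obtain ⟨x, hxz, hPx⟩ := ih z hz
      obtain ⟨x', hx'x, hPx'⟩ := hPer (τ k) x (hτneg k) hPx
      refine ⟨x', ?_, ?_⟩
      · rw [hsqrtτ k] at hx'x
        have h6 : L (k + 1) = 6 * L k := by rw [hL, hL, pow_succ]; ring
        calc ‖x' - z‖ ≤ ‖x' - x‖ + ‖x - z‖ := norm_sub_le_norm_sub_add_norm_sub _ _ _
          _ ≤ ρ * L k + ρ * L k := add_le_add hx'x hxz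
          _ ≤ ρ * L (k + 1) := by rw [h6]; nlinarith [hLpos k, hρ]
      · have e : 36 * τ k = τ (k + 1) := by rw [hτ, hτ, pow_succ]; ring
        rw [← e]; exact hPx'
  -- ### points near the admissible spheres at time `s` (guarded by `i σ_k ≤ R₀`) and their propagated level points
  have hz : ∀ (k i : ℕ), ∃ z : E3, ((i : ℝ) * σ k ≤ R₀ → |‖z - x₀‖ - i * σ k| ≤ g ∧ P s z) := by
    intro k i
    by_cases h : (i : ℝ) * σ k ≤ R₀
    · obtain ⟨z, hz1, hz2⟩ := hU (i * σ k) (mul_nonneg (Nat.cast_nonneg i) (hσpos k).le) h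
      exact ⟨z, fun _ => ⟨hz1, hz2⟩⟩
    · exact ⟨x₀, fun h' => absurd h' h⟩
  choose z hz using hz
  have hx : ∀ (k i : ℕ), ∃ x : E3, ((i : ℝ) * σ k ≤ R₀ → ‖x - z k i‖ ≤ ρ * L k ∧ P (τ k) x) := by
    intro k i
    by_cases h : (i : ℝ) * σ k ≤ R₀
    · obtain ⟨x, h1, h2⟩ := hiter k (z k i) (hz k i h).2
      exact ⟨x, fun _ => ⟨h1, h2⟩⟩
    · exact ⟨x₀, fun h' => absurd h' h⟩
  choose x hx using hx
  -- ### the boxes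
  obtain ⟨B, hB⟩ : ∃ B : ℕ → ℕ → Set (ℝ × E3),
      ∀ k i, B k i = Set.Icc ((1 + a) * τ k) (τ k) ×ˢ Metric.ball (x k i) (D * L k) := ⟨_, fun _ _ => rfl⟩
  have hBmeas : ∀ k i, MeasurableSet (B k i) := fun k i => by
    rw [hB]; exact measurableSet_Icc.prod measurableSet_ball
  have hBspend : ∀ k i, i < m k → ENNReal.ofReal (c * L k) ≤ μ (B k i) := by
    intro k i hi
    have h := hSp (τ k) (x k i) (hτneg k) (hx k i (hiσ k i hi)).2
    rw [hsqrtτ k] at h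
    rw [hB]; exact h
  -- separation within an epoch
  have hsep : ∀ k i i', i < i' → i' < m k →
      Disjoint (Metric.ball (x k i) (D * L k)) (Metric.ball (x k i') (D * L k)) := by
    intro k i i' hii' hi'
    have hi : i < m k := hii'.trans hi'
    apply Metric.ball_disjoint_ball
    have hic : (i : ℝ) + 1 ≤ i' := by exact_mod_cast hii'
    have h1 := abs_le.1 (hz k i (hiσ k i hi)).1
    have h2 := abs_le.1 (hz k i' (hiσ k i' hi')).1
    have hzz : σ k - 2 * g ≤ ‖z k i' - z k i‖ := by
      have h3 : ‖z k i' - x₀‖ - ‖z k i - x₀‖ ≤ ‖z k i' - z k i‖ := by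
        have e : z k i' - z k i = (z k i' - x₀) - (z k i - x₀) := by abel
        rw [e]; exact norm_sub_norm_le _ _
      nlinarith [h1.2, h2.1, hσpos k]
    have hxx : ‖z k i' - z k i‖ ≤ ‖x k i' - x k i‖ + ρ * L k + ρ * L k := by
      have e : z k i' - z k i = (x k i' - x k i) - (x k i' - z k i') + (x k i - z k i) := by abel
      rw [e]
      calc ‖(x k i' - x k i) - (x k i' - z k i') + (x k i - z k i)‖
          ≤ ‖(x k i' - x k i) - (x k i' - z k i')‖ + ‖x k i - z k i‖ := norm_add_le _ _
        _ ≤ ‖x k i' - x k i‖ + ‖x k i' - z k i'‖ + ‖x k i - z k i‖ := by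
            gcongr; exact norm_sub_le _ _
        _ ≤ _ := by linarith [(hx k i (hiσ k i hi)).1, (hx k i' (hiσ k i' hi')).1]
    rw [dist_eq_norm, norm_sub_rev]
    have e := hσ k
    linarith
  -- separation of the time intervals across epochs
  have htime : ∀ k k', k < k' → Disjoint (Set.Icc ((1 + a) * τ k) (τ k)) (Set.Icc ((1 + a) * τ k') (τ k')) := by
    intro k k' hkk'
    rw [Set.disjoint_left]
    intro p hp hp'
    have h1 : τ k' ≤ 36 * τ k := by
      have e : 36 * τ k = τ (k + 1) := by rw [hτ, hτ, pow_succ]; ring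
      rw [e]; exact hτmono (Nat.succ_le_of_lt hkk')
    have h2 : 36 * τ k < (1 + a) * τ k := by nlinarith [hτneg k]
    linarith [hp.1, hp'.2, h1, h2]
  -- ### the index set: epochs `k ≤ k₁`, sphere indices `i < m k`
  obtain ⟨I, hI⟩ : ∃ I : Finset ((_ : ℕ) × ℕ), I = (Finset.range (k₁ + 1)).sigma fun k => Finset.range (m k) :=
    ⟨_, rfl⟩
  have hmemI : ∀ p ∈ I, p.1 ≤ k₁ ∧ p.2 < m p.1 := by
    intro p hp
    rw [hI, Finset.mem_sigma, Finset.mem_range, Finset.mem_range] at hp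
    exact ⟨Nat.le_of_lt_succ hp.1, hp.2⟩
  have hpd : Set.PairwiseDisjoint (↑I : Set ((_ : ℕ) × ℕ)) (fun p => B p.1 p.2) := by
    intro p hp q hq hpq
    have hp2 := (hmemI p (Finset.mem_coe.1 hp)).2
    have hq2 := (hmemI q (Finset.mem_coe.1 hq)).2
    obtain ⟨k, i⟩ := p
    obtain ⟨k', i'⟩ := q
    show Disjoint (B k i) (B k' i')
    rw [hB, hB, Set.disjoint_prod]
    rcases lt_trichotomy k k' with hlt | heq | hgt
    · exact Or.inl (htime k k' hlt)
    · subst heq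
      right
      rcases lt_trichotomy i i' with hlt' | heq' | hgt'
      · exact hsep k i i' hlt' hq2
      · exact absurd (by subst heq'; rfl) hpq
      · exact (hsep k i' i hgt' hp2).symm
    · exact Or.inl (htime k' k hgt).symm
  -- ### every box lies in the big cylinder `[(1+a) τ k₁, s] × B(x₀, R)`
  have hBsub : ∀ p ∈ I, B p.1 p.2 ⊆ Set.Icc ((1 + a) * τ k₁) s ×ˢ Metric.ball x₀ R := by
    intro p hp
    obtain ⟨hk, hi⟩ := hmemI p hp
    have hg1 := hiσ p.1 p.2 hi
    rw [hB]
    refine Set.prod_mono (Set.Icc_subset_Icc ?_ (hτles _)) ?_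
    · exact mul_le_mul_of_nonneg_left (hτmono hk) (by linarith)
    · apply Metric.ball_subset_ball'
      rw [dist_eq_norm]
      have h1 := abs_le.1 (hz p.1 p.2 hg1).1
      have hxle : ‖x p.1 p.2 - x₀‖ ≤ ‖x p.1 p.2 - z p.1 p.2‖ + ‖z p.1 p.2 - x₀‖ :=
        norm_sub_le_norm_sub_add_norm_sub _ _ _
      have hLk := hLmono hk
      rw [hR]
      nlinarith [(hx p.1 p.2 hg1).1, h1.2, hD, hρ, hLpos p.1]
  -- ### the ledger inequality in `ℝ≥0∞`, then in `ℝ`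
  have hτ1s : (1 + a) * τ k₁ < s := by
    have h1 : (1 + a) * τ k₁ < τ k₁ := by nlinarith [hτneg k₁]
    exact h1.trans_le (hτles k₁)
  have hτR : -((1 + a) * τ k₁) ≤ R ^ 2 := by
    have h1 : -((1 + a) * τ k₁) = (1 + a) * L k₁ ^ 2 := by rw [hLsq]; ring
    have h2 : 2 * L k₁ ≤ R := by
      have h3 : 0 ≤ (ρ + D) * L k₁ := mul_nonneg (by linarith) (hLpos k₁).le
      have h4 : (ρ + D + 2) * L k₁ = (ρ + D) * L k₁ + 2 * L k₁ := by ring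
      rw [hR]; linarith [hLpos k₁, hR₀pos, hg, h3, h4]
    have h3 : (2 * L k₁) ^ 2 ≤ R ^ 2 := pow_le_pow_left₀ (by linarith [hLpos k₁]) h2 2
    have h4 : (1 + a) * L k₁ ^ 2 ≤ (2 * L k₁) ^ 2 := by
      rw [show (2 * L k₁) ^ 2 = 4 * L k₁ ^ 2 by ring]
      exact mul_le_mul_of_nonneg_right (by linarith) (sq_nonneg _)
    rw [h1]; linarith
  have key : ENNReal.ofReal (∑ p ∈ I, c * L p.1) ≤ ENNReal.ofReal (E' * R) := by
    calc ENNReal.ofReal (∑ p ∈ I, c * L p.1)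
        = ∑ p ∈ I, ENNReal.ofReal (c * L p.1) :=
          ENNReal.ofReal_sum_of_nonneg fun p _ => (mul_pos hc (hLpos _)).le
      _ ≤ ∑ p ∈ I, μ (B p.1 p.2) := Finset.sum_le_sum fun p hp => hBspend p.1 p.2 (hmemI p hp).2
      _ = μ (⋃ p ∈ I, B p.1 p.2) := (measure_biUnion_finset hpd fun p _ => hBmeas p.1 p.2).symm
      _ ≤ μ (Set.Icc ((1 + a) * τ k₁) s ×ˢ Metric.ball x₀ R) :=
          measure_mono (Set.iUnion₂_subset fun p hp => hBsub p hp)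
      _ ≤ ENNReal.ofReal (E * R) := hBud R _ _ hRpos hτ1s hs hτR
      _ ≤ ENNReal.ofReal (E' * R) := ENNReal.ofReal_le_ofReal (mul_le_mul_of_nonneg_right hEE' hRpos.le)
  have hS : ∑ p ∈ I, c * L p.1 = ∑ k ∈ Finset.range (k₁ + 1), (m k : ℝ) * (c * L k) := by
    rw [hI, Finset.sum_sigma]
    refine Finset.sum_congr rfl fun k _ => ?_
    show ∑ i ∈ Finset.range (m k), c * L k = _
    rw [Finset.sum_const, Finset.card_range, nsmul_eq_mul]
  -- per-epoch spending `≥ c R₀/Γ - c L k₁`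
  have hep : ∀ k ∈ Finset.range (k₁ + 1), c * R₀ / Γ - c * L k₁ ≤ (m k : ℝ) * (c * L k) := by
    intro k hk
    have hk' : k ≤ k₁ := Nat.le_of_lt_succ (Finset.mem_range.1 hk)
    have h1 : R₀ / (Γ * L k) ≤ R₀ / σ k := div_le_div_of_nonneg_left hR₀pos.le (hσpos k) (hσΓ k)
    have h2 := hmge k
    have h3 : R₀ / (Γ * L k) * (c * L k) = c * R₀ / Γ := by
      field_simp [(hLpos k).ne', hΓpos.ne']
    have h4 : (R₀ / (Γ * L k) - 1) * (c * L k) ≤ (m k : ℝ) * (c * L k) :=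
      mul_le_mul_of_nonneg_right (by linarith) (mul_pos hc (hLpos k)).le
    have h5 := hLmono hk'
    nlinarith [h3, h4, hc]
  have hSge : ((k₁ : ℝ) + 1) * (c * R₀ / Γ - c * L k₁) ≤ ∑ p ∈ I, c * L p.1 := by
    rw [hS]
    have h := Finset.sum_le_sum hep
    rw [Finset.sum_const, Finset.card_range, nsmul_eq_mul] at h
    push_cast at h
    linarith
  -- the contradiction
  have hfin : ∑ p ∈ I, c * L p.1 ≤ E' * R ∨ ∑ p ∈ I, c * L p.1 ≤ 0 := ENNReal.ofReal_le_ofReal_iff'.1 key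
  have hgap : E' * R < ((k₁ : ℝ) + 1) * (c * R₀ / Γ - c * L k₁) := by
    have h1 : (E' + 1) * R₀ ≤ ((k₁ : ℝ) + 1) * (c * R₀ / Γ) := by
      have h2 : ((k₁ : ℝ) + 1) * (c * R₀ / Γ) = ((k₁ : ℝ) + 1) * c / Γ * R₀ := by ring
      rw [h2]
      refine mul_le_mul_of_nonneg_right ?_ hR₀pos.le
      rw [le_div_iff₀ hΓpos]; exact hcoef
    rw [hR]
    have h3 : R₀ = σ 0 + E' * g + (E' * (ρ + D + 2) + ((k₁ : ℝ) + 1) * c) * L k₁ + 1 := hR₀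
    nlinarith [h1, hσpos 0, hE'0, hLpos k₁]
  have hERnn : 0 ≤ E' * R := mul_nonneg hE'0 hRpos.le
  rcases hfin with h | h <;> linarith

/-- The local chain Liouville theorem from the two ANALYTIC stubs only (L3ˡᵒᶜ proved above). -/
theorem localChainLiouville_of (hL1 : UniformDissipationBudget) (hL2 : ViolatorDissipation) : LocalChainLiouville :=
  localChainLiouville_of_ledger ledgerCountLocal_holds hL1 hL2

/-! ## §3 The three registered stubs (T♮ heart · L1ᵘ · L2) and their registration-style names -/

/-- REGISTERED STUB T♮ (heart, XL). -/
theorem stub_tightOrChain : TightOrChain := by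
  sorry

/-- REGISTERED STUB L1ᵘ (L). -/
theorem stub_uniformDissipationBudget : UniformDissipationBudget := by
  sorry

/-- REGISTERED STUB L2 (M; same statement as g10-α's `stub_violatorDissipation`). -/
theorem stub_violatorDissipation : ViolatorDissipation := by
  sorry

/-! Registration-style names: the skeleton's hypotheses are typed by these abbreviations (head constant = a `stub_*` name). -/
namespace Registered

/-- = `TightOrChain`. -/
abbrev stub_tightOrChain : Prop := TightOrChain
/-- = `UniformDissipationBudget`. -/
abbrev stub_uniformDissipationBudget : Prop := UniformDissipationBudget
/-- = `ViolatorDissipation`. -/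
abbrev stub_violatorDissipation : Prop := ViolatorDissipation

end Registered

/-! ## §4 THE SKELETON: T♮ + L1ᵘ + L2 ⇒ the crux BY NAME (kernel-checked, no `sorry` outside the three stubs; F1, T0, T2′, G′, L3ˡᵒᶜ, the
propagation and the extremal-branch exclusion are theorems) -/

/-- **LINE g10-β SKELETON — the crux from the three stubs T♮, L1ᵘ, L2 (via the local chain Liouville theorem).**  Violator frame by
contradiction → F1 budget `A` (`flowFilamentBudget`) → T0 data (`efficientTimesNoDust_holds`) → T2′ zoom family + flow compactness
(`zoomPackageFlow`) → eventual growth of the members (`ballEnergy_zoom_le`) → T♮: centres, subsequence, limit `W₀`, dichotomy → flow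
compactness at those centres: `W₀ = W s`, `W` Type-I ancient mild → G′ (`growthTransferFlow`): all-time growth → tight branch:
`not_isExtremalSlice_of_typeIAncientMild`; chain branch: `LocalChainLiouville` at the length `d(K,A,g,η,s)`. -/
theorem NearExtremalTransiencePerFlow_of
    (hT : Registered.stub_tightOrChain)
    (hL1 : Registered.stub_uniformDissipationBudget) (hL2 : Registered.stub_violatorDissipation) :
    NearExtremalTransiencePerFlow := by
  -- the local ledger's Liouville theorem from L1ᵘ, L2 (L3ˡᵒᶜ and the backward-cone propagation are theorems)
  have hL : LocalChainLiouville := localChainLiouville_of hL1 hL2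
  have hT0 : EfficientTimesNoDust := efficientTimesNoDust_holds
  intro C ν T hC hν hT' u p hsol hLH hdec hrate hsing
  by_contra hno
  have hV : IsViolator C ν T u p := ⟨hC, hν, hT', hsol, hLH, hdec, hrate, hsing, hno⟩
  -- F1: the filament budget of the flow (landed)
  obtain ⟨A, hA⟩ := FilamentGap.flowFilamentBudget C ν T hC hν hT' u p hsol hLH hdec hrate
  -- T0: near-efficient late times with a Taylor bound (landed)
  obtain ⟨Θ, t, Mb, ε, hdata⟩ := hT0 C ν T u p hV
  -- T2′: zoom family and flow-level compactness (landed)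
  obtain ⟨σ, Λ, Θ', ε', hσ, hfam, hcompF⟩ := FilamentSelection.zoomPackageFlow C ν T u p hV Θ t Mb ε hdata
  -- the zoom family
  set V : ℕ → E3 → E3 := fun n z => (Mb (σ n))⁻¹ • u (t (σ n)) ((ν / Mb (σ n)) • z) with hVdef
  -- eventual growth of the members (F1 + scale invariance of the budget)
  have htT : Tendsto (fun n => t (σ n)) atTop (𝓝[<] T) := by
    have h1 : Tendsto (fun n => t (σ n)) atTop (𝓝 T) := hdata.2.1.comp hσ.tendsto_atTop
    exact tendsto_nhdsWithin_iff.2 ⟨h1, Eventually.of_forall fun n => (hdata.1 (σ n)).2⟩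
  have hgrV : ∀ᶠ n in atTop, ∀ (x : E3) (R : ℝ), 0 < R → ∫ z in Metric.ball x R, ‖V n z‖ ^ 2 ≤ A * R := by
    filter_upwards [htT.eventually hA] with n hn x R hR
    have h := FilamentSelection.ballEnergy_zoom_le hν (hdata.2.2.2.1 (σ n)) hn 0 x hR
    simpa only [zero_add] using h
  -- T♮: centres, subsequence, limit, dichotomy
  obtain ⟨y, φ, W₀, hφ, hconv, hdich⟩ := hT V Λ Θ' ε' A hfam hgrV
  -- T2′ compactness at these centres
  obtain ⟨ψ, K, s, W, hψ, hW, hs, hpin, hconvF⟩ := hcompF y φ hφ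
  -- the slice family is the instance `τ = s` of the flow-level convergence, so `W s = W₀`
  have hconv' : ∀ z : E3, Tendsto (fun n => V (φ (ψ n)) (y (φ (ψ n)) + z)) atTop (𝓝 (W s z)) := by
    intro z
    have h1 := hconvF s hs z
    simp only [sub_self, mul_zero, add_zero] at h1
    exact h1
  have hWs : W s = W₀ :=
    funext fun z => tendsto_nhds_unique (hconv' z) ((hconv z).comp hψ.tendsto_atTop)
  subst hWs
  -- G′ at every rescaled time (landed)
  have htT' : Tendsto (fun n => t (σ (φ (ψ n)))) atTop (𝓝 T) :=
    hdata.2.1.comp ((hσ.comp (hφ.comp hψ)).tendsto_atTop)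
  have hgrowthAll : HasLinGrowthAllTime A W := by
    intro τ hτ
    exact FilamentSelection.growthTransferFlow ν A T u (fun n => t (σ (φ (ψ n)))) (fun n => Mb (σ (φ (ψ n))))
      (fun n => y (φ (ψ n))) s τ (W τ) hν hT' (fun n => hdata.2.2.2.1 _) (fun n => (hdata.1 _).2) htT'
      (fun t' ht' => (hsol.contDiff_velocity ht').continuous) hA hs hpin hτ (hconvF τ hτ)
  rcases hdich with hext | ⟨g, η, hη, hchain⟩
  · -- tight branch: an exactly extremal slice of a Type-I ancient mild field — excluded unconditionally (landed)
    exact not_isExtremalSlice_of_typeIAncientMild hW hs hext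
  · -- chain branch: the local chain Liouville theorem at the length `d(K, A, g, η, s)`
    obtain ⟨d, -, hLd⟩ := hL K A g η s hs hη
    obtain ⟨z₀, hz₀⟩ := hchain d
    exact hLd W z₀ hW hgrowthAll hz₀

/-- Sanity: the skeleton applied to the three `sorry`-stubs elaborates and concludes the route decl (an `example`, so that the skeleton
theorem above is the ONLY declaration concluding the crux). -/
example : NearExtremalTransiencePerFlow :=
  NearExtremalTransiencePerFlow_of stub_tightOrChain stub_uniformDissipationBudget stub_violatorDissipation

end Summit.NavierStokesRegularity.NavierStokesRegularity.Cruxes.NearExtremalTransiencePerFlow.TightOrChain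

end
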